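import Literature.NumberTheory.EllipticCurves.SerreOpenImageSupersingularParameterProofs
import Literature.NumberTheory.EllipticCurves.SerreOpenImageReductionInertiaProofs
import Mathlib.RingTheory.Polynomial.Cyclotomic.Roots
import HarnessLib

/-!
# Serre 1972, §1.11, Prop. 12 c) over `ℚ`: at a good supersingular prime the image of inertia
# on `E[ℓ]` is cyclic of order `ℓ² - 1` — from the tame Kummer character

Topic `NumberTheory/EllipticCurves`.  Theorems only (nothing is defined, no named fact).  Let
`E = W/ℚ` be in global minimal form, `ℓ` an odd prime of good supersingular reduction, `𝒪 = 𝒪_𝔓`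
the place of `ℚ̄` over `ℓ` (`placeOver ℓ`), `𝔓 ⊂ \bar ℤ` its prime and `I = I_𝔓 ≤ Γ_ℚ` the
inertia group.  J.-P. Serre, Invent. Math. 15 (1972), §1.11, Prop. 12 (`e = 1`) c): *"L'image
de `I` dans `Aut(E_p)` est un groupe cyclique d'ordre `p² - 1`"* (a non-split Cartan subgroup).
Serre's proof: `E_p` is the kernel of `[p]` on a formal group of height `2`, on which the tame
inertia acts through the fundamental character `θ_{p²-1}` of level `2` (Prop. 9–10), which maps
`I_t` onto `μ_{p²-1}` (§1.3, Prop. 1, Kummer theory).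

This file proves the statement for the place's prime `𝔓`
(`isCyclic_and_card_inertia_map_of_dvd_frobeniusTrace`) from the elementary valuation theory of
the parameters `t = x/y` of the points of `E[ℓ]` (`SerreOpenImageSupersingularValuationProofs`,
`SerreOpenImageSupersingularParameterProofs`) and **one hypothesis**, the surjectivity of the
tame Kummer character on the *global* inertia group (`§1.3`): for `π ∈ ℚ̄` with
`π^{ℓ² - 1} = ℓ` and every `(ℓ² - 1)`-th root of unity `ζ` there is `s ∈ I_𝔓` with `s π = ζ π`.
The argument: for `s ∈ I` and `P ∈ E[ℓ] ∖ 0` one has `t(sP) = s(t(P))`, all parameters have the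
valuation of `π`, and `s` acts trivially on `𝒪/𝔪`; so `s ↦ θ(s) = s(t₀)/t₀ mod 𝔪 ∈ \bar 𝔽_ℓˣ`
is a character of `I` (independent of the point), and since distinct points have parameters at
distance `v(π)` (`valuation_param_sub_eq`), **`ρ̄(s) = 1 ⟺ θ(s) = 1`**.  Hence
`ρ̄(I) ≅ θ(I) ≤ μ_{ℓ²-1}(\bar 𝔽_ℓ)`, cyclic of order `≤ ℓ² - 1`, and `= ℓ² - 1` as soon as
`θ(I) ∋ ζ̄` for a primitive root `ζ` (roots of unity of order prime to `ℓ` stay distinct mod `𝔓`).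

## References

* [Serre1972] J.-P. Serre, Invent. Math. 15 (1972) 259–331, §1.3 (Prop. 1–2), §1.9–1.11
  (Prop. 9, 10, 12).
-/

noncomputable section

open scoped Classical NumberField Pointwise
open IsDedekindDomain Field Polynomial WeierstrassCurve

namespace Literature.NumberTheory.EllipticCurves

open Literature.NumberTheory.GaloisRepresentations Rat.HeightOneSpectrum

variable (ℓ : ℕ) [Fact ℓ.Prime] {W : WeierstrassCurve ℚ} [W.IsGloballyMinimal]

/-! ### Preliminaries -/

/-- In a linearly ordered commutative group with zero: `a / c < 1 ↔ a < c` for `c ≠ 0`.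
[folklore] -/
theorem div_lt_one_iff_of_ne_zero {Γ₀ : Type*} [LinearOrderedCommGroupWithZero Γ₀] {a c : Γ₀}
    (hc : c ≠ 0) : a / c < 1 ↔ a < c := by
  constructor
  · intro h
    have := mul_lt_mul_left_of_ne_zero hc h
    rwa [mul_div_cancel₀ _ hc, mul_one] at this
  · intro h
    by_contra hle
    rw [not_lt] at hle
    have : c * 1 ≤ c * (a / c) := mul_le_mul' le_rfl hle
    rw [mul_one, mul_div_cancel₀ _ hc] at this
    exact absurd this (not_le.mpr h)

/-- **Roots of unity of order prime to `ℓ` are distinct modulo `𝔓`** (Serre 1972, §1.3: `μ_d`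
injects into the residue field for `p ∤ d`): if `η^n = 1`, `ℓ ∤ n` and `η ≡ 1 (mod 𝔪_𝔓)` then
`η = 1`.  (`η^n - 1 = (η - 1)(1 + η + ⋯ + η^{n-1})` and the second factor is `≡ n`, a unit.)
[cite: Serre1972, §1.3] -/
theorem eq_one_of_pow_eq_one_of_valuation_sub_one_lt {n : ℕ} (hn : ¬ (ℓ : ℤ) ∣ (n : ℤ))
    {η : AlgebraicClosure ℚ} (hη : η ^ n = 1)
    (hv : (placeOver ℓ).valuation (η - 1) < 1) : η = 1 := by
  set v := (placeOver ℓ).valuation with hvdef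
  have hn0 : n ≠ 0 := by rintro rfl; exact hn (by simp)
  -- `v η = 1` and `v (η^i - 1) < 1`
  have hη1 : v η ≤ 1 := by
    have : v (η - 1 + 1) ≤ 1 := Valuation.map_add_le _ hv.le (by rw [map_one])
    rwa [sub_add_cancel] at this
  have hpow : ∀ i : ℕ, v (η ^ i - 1) < 1 := by
    intro i
    rw [← mul_geom_sum η i, map_mul]  -- `(η - 1) * ∑ η^j = η^i - 1`
    calc v (η - 1) * v (∑ j ∈ Finset.range i, η ^ j) ≤ v (η - 1) * 1 := by
          refine mul_le_mul' le_rfl (Valuation.map_sum_le _ fun j _ ↦ ?_)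
          rw [map_pow]; exact pow_le_one₀ zero_le hη1
      _ < 1 := by rwa [mul_one]
  -- `S = ∑_{i<n} η^i ≡ n`, a unit
  have hvn : v (n : AlgebraicClosure ℚ) = 1 := by
    have := valuation_placeOver_intCast_eq_one ℓ hn
    rwa [Int.cast_natCast] at this
  have hS : v (∑ i ∈ Finset.range n, η ^ i) = 1 := by
    have hdiff : v (∑ i ∈ Finset.range n, (η ^ i - 1)) < 1 :=
      Valuation.map_sum_lt _ one_ne_zero fun i _ ↦ hpow i
    have heq : ∑ i ∈ Finset.range n, η ^ i = (n : AlgebraicClosure ℚ) +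
        ∑ i ∈ Finset.range n, (η ^ i - 1) := by
      rw [Finset.sum_sub_distrib, Finset.sum_const, Finset.card_range, nsmul_eq_mul, mul_one]
      ring
    rw [heq, Valuation.map_add_eq_of_lt_left _ (by rwa [hvn]), hvn]
  -- `0 = η^n - 1 = (η - 1) S`
  have h0 : (η - 1) * ∑ i ∈ Finset.range n, η ^ i = 0 := by rw [mul_geom_sum, hη, sub_self]
  rcases mul_eq_zero.mp h0 with h | h
  · exact sub_eq_zero.mp h
  · rw [h, map_zero] at hS; exact absurd hS zero_ne_one

/-- `ρ̄_{E,n}(σ) = 1` iff `σ` fixes `E[n]` pointwise (a local copy of the tree's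
`WeierstrassCurve.galoisRepTorsion_eq_one_iff`, `SupersingularDensitySerreLadicProofs`, kept here
to keep the import closure light). [folklore] -/
theorem galoisRepTorsion_eq_one_iff' {F : Type*} [Field F] (V : WeierstrassCurve F) (n : ℤ)
    (σ : absoluteGaloisGroup F) :
    galoisRepTorsion V n σ = 1 ↔ ∀ P : geomTorsion V n, σ • P = P := by
  constructor
  · intro h P
    rw [← galoisRepTorsion_apply, h]
    rfl
  · intro h
    refine Multiplicative.toAdd.injective (AddEquiv.ext fun P ↦ ?_)
    rw [galoisRepTorsion_apply]
    exact h P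

/-- A nonzero geometric point has affine coordinates; this is the tree's
`geomPoints.exists_eq_some` (`EllipticCurves/FunctionFieldTranslation`), kept under its old name as
a deprecated alias (dedup-00792). [folklore] -/
@[deprecated geomPoints.exists_eq_some (since := "2026-08-15")]
theorem exists_eq_some_of_ne_zero {F : Type*} [Field F] {V : WeierstrassCurve F}
    (P : V.geomPoints) (hP : P ≠ 0) : ∃ x y h, P = .some x y h :=
  geomPoints.exists_eq_some hP

omit [W.IsGloballyMinimal] in
/-- `Γ_ℚ` acts on geometric points coordinatewise: `σ • (x, y) = (σ x, σ y)`. [folklore] -/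
theorem exists_smul_eq_some (σ : absoluteGaloisGroup ℚ) {P : W.geomPoints}
    {x y : AlgebraicClosure ℚ} {h} (hP : P = .some x y h) :
    ∃ h', σ • P = .some (σ • x) (σ • y) h' := by
  subst hP
  have hφinj : Function.Injective (absoluteGaloisGroup.toAlgEquiv ℚ σ).toAlgHom :=
    (absoluteGaloisGroup.toAlgEquiv ℚ σ).injective
  exact ⟨(Affine.baseChange_nonsingular (W := W.toAffine) hφinj x y).mpr h, rfl⟩

/-- The action on the parameter: `t(σ P) = σ t(P)`. [folklore] -/
theorem smul_div_eq (σ : absoluteGaloisGroup ℚ) (x y : AlgebraicClosure ℚ) :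
    σ • x / σ • y = σ • (x / y) := by
  rw [absoluteGaloisGroup.smul_def, absoluteGaloisGroup.smul_def, absoluteGaloisGroup.smul_def,
    map_div₀]

/-- Residues of `𝔓`-integers congruent modulo `𝔪` agree. [folklore] -/
theorem placeResidueMap_eq_of_valuation_sub_lt {a b : placeOver ℓ}
    (h : (placeOver ℓ).valuation ((a : AlgebraicClosure ℚ) - b) < 1) :
    placeResidueMap ℓ a = placeResidueMap ℓ b := by
  rw [← sub_eq_zero, ← map_sub, placeResidueMap_eq_zero_iff]
  exact h

/-! ### Torsion points under inertia at a supersingular prime -/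

section Supersingular

variable [W.IsElliptic] (hΔ : ¬ (ℓ : ℤ) ∣ minimalDiscriminantInt W)
  (hss : (ℓ : ℤ) ∣ W.frobeniusTrace ℓ) (hℓ2 : ℓ ≠ 2)
include hΔ hss hℓ2

/-- All nonzero `ℓ`-torsion points have parameters of the same valuation (`v(t)^{ℓ²-1} = v(ℓ)`).
[cite: Serre1972, §1.11 Prop. 12] -/
theorem valuation_param_eq_of_zsmul_eq_zero {P Q : W.geomPoints} (hP : (ℓ : ℤ) • P = 0)
    (hQ : (ℓ : ℤ) • Q = 0) {x₁ y₁ x₂ y₂ : AlgebraicClosure ℚ} {h₁ h₂} (hP₁ : P = .some x₁ y₁ h₁)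
    (hQ₂ : Q = .some x₂ y₂ h₂) :
    (placeOver ℓ).valuation (x₁ / y₁) = (placeOver ℓ).valuation (x₂ / y₂) := by
  have hp : ℓ.Prime := Fact.out
  obtain ⟨-, h1⟩ := valuation_param_pow_eq ℓ hΔ hss hℓ2 hP hP₁
  obtain ⟨-, h2⟩ := valuation_param_pow_eq ℓ hΔ hss hℓ2 hQ hQ₂
  have hn : ℓ ^ 2 - 1 ≠ 0 := by
    have : 4 ≤ ℓ ^ 2 := by nlinarith [hp.two_le]
    omega
  exact pow_left_injective_of_ne_zero hn (h1.trans h2.symm)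

/-- **If `s ∈ I_𝔓` moves the parameter of one nonzero point of `E[ℓ]` by less than its size, it
fixes `E[ℓ]` pointwise.**  With `t = t₀ w`, `w` a `𝔓`-unit: `s t - t = (s t₀ - t₀) s w +
t₀ (s w - w)` has valuation `< v(t₀) = v(t)` (inertia acts trivially on `𝒪/𝔪`), while for
`s P ≠ P` the parameters `t(sP) = s t` and `t(P)` would be at distance exactly `v(t)`
(`valuation_param_sub_eq`). [cite: Serre1972, §1.10–1.11] -/
theorem smul_eq_self_of_valuation_smul_param_sub_lt {𝔓 : Ideal (absIntegers (𝓞 ℚ) ℚ)}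
    (hmem : ∀ x : absIntegers (𝓞 ℚ) ℚ, x ∈ 𝔓 ↔ (x : AlgebraicClosure ℚ) ∈ (placeOver ℓ).nonunits)
    {s : absoluteGaloisGroup ℚ} (hs : s ∈ 𝔓.inertia (absoluteGaloisGroup ℚ))
    {P₀ : W.geomPoints} (hP₀ : (ℓ : ℤ) • P₀ = 0) {x₀ y₀ : AlgebraicClosure ℚ} {h₀}
    (hP₀xy : P₀ = .some x₀ y₀ h₀)
    (hlt : (placeOver ℓ).valuation (s • (x₀ / y₀) - x₀ / y₀) <
      (placeOver ℓ).valuation (x₀ / y₀)) :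
    ∀ P : geomTorsion W ℓ, s • P = P := by
  set v := (placeOver ℓ).valuation with hv
  set t₀ := x₀ / y₀ with ht₀
  have hstab := smul_placeOver_eq_of_mem_inertia (p := ℓ) hmem hs
  have hmemτ : ∀ z : AlgebraicClosure ℚ, s • z ∈ placeOver ℓ ↔ z ∈ placeOver ℓ := by
    intro z
    conv_lhs => rw [← hstab]
    rw [absoluteGaloisGroup.smul_def]
    exact ValuationSubring.smul_mem_pointwise_smul_iff
  have ht₀0 : v t₀ ≠ 0 := by
    obtain ⟨hlt1, hpow⟩ := valuation_param_pow_eq ℓ hΔ hss hℓ2 hP₀ hP₀xy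
    intro h0
    have hp : ℓ.Prime := Fact.out
    rw [← ht₀, h0, zero_pow (by
      have : 4 ≤ ℓ ^ 2 := by nlinarith [hp.two_le]
      omega)] at hpow
    exact (Valuation.ne_zero_iff v).mpr (by exact_mod_cast hp.ne_zero) hpow.symm
  have ht₀ne : t₀ ≠ 0 := fun h ↦ ht₀0 (by rw [h, map_zero])
  intro P
  by_cases hP0 : P = 0
  · rw [hP0, smul_zero]
  -- coordinates and parameter of `P`
  have hP0' : (P : W.geomPoints) ≠ 0 := fun h ↦ hP0 (Subtype.ext h)
  obtain ⟨x, y, h, hPxy⟩ := geomPoints.exists_eq_some (P := (P : W.geomPoints)) hP0'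
  have hPt : (ℓ : ℤ) • (P : W.geomPoints) = 0 := (Submodule.mem_torsionBy_iff _ _).mp P.2
  set t := x / y with htdef
  have hvt : v t = v t₀ := valuation_param_eq_of_zsmul_eq_zero ℓ hΔ hss hℓ2 hPt hP₀ hPxy hP₀xy
  -- `w = t / t₀` is a `𝔓`-unit and `s` fixes it modulo `𝔪`
  set w := t / t₀ with hwdef
  have htw : t = t₀ * w := by rw [hwdef, mul_div_cancel₀ _ ht₀ne]
  have hvw : v w = 1 := by rw [hwdef, map_div₀, hvt, div_self ht₀0]
  have hwmem : w ∈ placeOver ℓ := (ValuationSubring.valuation_le_one_iff _ _).mp hvw.le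
  have hsw : v (s • w - w) < 1 := valuation_smul_sub_lt_one_of_mem_inertia hmem hs hwmem
  have hvsw : v (s • w) ≤ 1 := (ValuationSubring.valuation_le_one_iff _ _).mpr ((hmemτ w).mpr hwmem)
  -- `v (s t - t) < v t`
  have hkey : v (s • t - t) < v t := by
    have hdecomp : s • t - t = (s • t₀ - t₀) * (s • w) + t₀ * (s • w - w) := by
      rw [htw, smul_mul']; ring
    rw [hdecomp, hvt]
    refine Valuation.map_add_lt _ ?_ ?_
    · rw [map_mul]
      calc v (s • t₀ - t₀) * v (s • w) ≤ v (s • t₀ - t₀) * 1 := mul_le_mul' le_rfl hvsw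
        _ < v t₀ := by rw [mul_one]; exact hlt
    · rw [map_mul]
      calc v t₀ * v (s • w - w) < v t₀ * 1 := mul_lt_mul_left_of_ne_zero ht₀0 hsw
        _ = v t₀ := mul_one _
  -- the point `s • P` and its parameter `s t`
  by_contra hne
  have hne' : ((s • P : geomTorsion W ℓ) : W.geomPoints) ≠ (P : W.geomPoints) :=
    fun h ↦ hne (Subtype.ext h)
  have hsP : ((s • P : geomTorsion W ℓ) : W.geomPoints) = s • (P : W.geomPoints) := rfl
  obtain ⟨h', hsPxy⟩ := exists_smul_eq_some (W := W) s hPxy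
  rw [← hsP] at hsPxy
  have hsPt : (ℓ : ℤ) • ((s • P : geomTorsion W ℓ) : W.geomPoints) = 0 :=
    (Submodule.mem_torsionBy_iff _ _).mp (s • P).2
  have hfar := valuation_param_sub_eq ℓ hΔ hss hℓ2 hsPt hPt hne' hsPxy hPxy
  rw [smul_div_eq, ← htdef] at hfar
  -- `v (s t - t) = v (s t) = v t`, contradiction
  have hvst : v (s • t) = v t := by
    have := valuation_param_eq_of_zsmul_eq_zero ℓ hΔ hss hℓ2 hsPt hPt hsPxy hPxy
    rwa [smul_div_eq, ← htdef] at this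
  rw [hvst] at hfar
  exact (lt_irrefl _) (hfar ▸ hkey)

/-- **Serre 1972, §1.11, Prop. 12 c) at the place's prime, from the tame Kummer character.**
Let `E/ℚ` be minimal, `ℓ` an odd prime of good supersingular reduction, `𝔓` the prime of `\bar ℤ`
cut out by the place `placeOver ℓ` and `I = I_𝔓 ≤ Γ_ℚ`.  Assume the surjectivity of the tame
character of level `ℓ² - 1` on `I` (§1.3, Prop. 1–2, totally ramified Kummer theory): for
`π ∈ ℚ̄` with `π^{ℓ²-1} = ℓ` and every `ζ` with `ζ^{ℓ²-1} = 1` some `s ∈ I` has `s π = ζ π`.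
Then the image of `I` in `Aut(E[ℓ])` under `ρ̄_{E,ℓ}` is **cyclic of order `ℓ² - 1`**.
[cite: Serre1972, §1.11 Prop. 12 c); §1.3 Prop. 1] -/
theorem isCyclic_and_card_inertia_map_of_dvd_frobeniusTrace
    {𝔓 : Ideal (absIntegers (𝓞 ℚ) ℚ)}
    (hmem : ∀ x : absIntegers (𝓞 ℚ) ℚ, x ∈ 𝔓 ↔ (x : AlgebraicClosure ℚ) ∈ (placeOver ℓ).nonunits)
    (hT : ∀ π ζ : AlgebraicClosure ℚ, π ^ (ℓ ^ 2 - 1) = ℓ → ζ ^ (ℓ ^ 2 - 1) = 1 →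
      ∃ s ∈ 𝔓.inertia (absoluteGaloisGroup ℚ), s • π = ζ * π) :
    IsCyclic ((𝔓.inertia (absoluteGaloisGroup ℚ)).map (galoisRepTorsion W ℓ)) ∧
      Nat.card ((𝔓.inertia (absoluteGaloisGroup ℚ)).map (galoisRepTorsion W ℓ)) = ℓ ^ 2 - 1 := by
  have hp : ℓ.Prime := Fact.out
  set v := (placeOver ℓ).valuation with hv
  set I := 𝔓.inertia (absoluteGaloisGroup ℚ) with hI
  set ρ := galoisRepTorsion W ℓ with hρ
  set r := placeResidueMap ℓ with hr
  set n := ℓ ^ 2 - 1 with hn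
  have hℓ2' : 4 ≤ ℓ ^ 2 := by nlinarith [hp.two_le]
  have hn0 : n ≠ 0 := by omega
  have hnpos : 0 < n := Nat.pos_of_ne_zero hn0
  have hnℓ : ¬ (ℓ : ℤ) ∣ (n : ℤ) := by
    intro h
    have h1 : (ℓ : ℤ) ∣ ((ℓ ^ 2 : ℕ) : ℤ) := by push_cast; exact dvd_pow_self _ two_ne_zero
    have h2 : (ℓ : ℤ) ∣ ((ℓ ^ 2 : ℕ) : ℤ) - (n : ℤ) := dvd_sub h1 h
    have h3 : ((ℓ ^ 2 : ℕ) : ℤ) - (n : ℤ) = 1 := by rw [hn]; omega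
    rw [h3] at h2
    exact hp.one_lt.ne' (by exact_mod_cast Int.eq_one_of_dvd_one (by positivity) h2)
  have hvℓ0 : v ℓ ≠ 0 := by rw [hv, Valuation.ne_zero_iff]; exact_mod_cast hp.ne_zero
  have hℓ0 : ((ℓ : ℕ) : AlgebraicClosure ℚ) ≠ 0 := Nat.cast_ne_zero.mpr hp.ne_zero
  -- integrality tests
  have hmem1 : ∀ {z : AlgebraicClosure ℚ}, v z = 1 → z ∈ placeOver ℓ := fun hz ↦
    (ValuationSubring.valuation_le_one_iff _ _).mp hz.le
  have hres1 : ∀ {a : placeOver ℓ}, r a = 1 ↔ v ((a : AlgebraicClosure ℚ) - 1) < 1 := by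
    intro a
    rw [← (placeResidueMap ℓ).map_one]
    constructor
    · intro h
      have : r (a - 1) = 0 := by rw [map_sub, h, map_one, sub_self]
      rwa [hr, placeResidueMap_eq_zero_iff] at this
    · intro h
      exact placeResidueMap_eq_of_valuation_sub_lt ℓ h
  -- a nonzero torsion point `P₀ = (x₀, y₀)` and its parameter `t₀`
  letI : Module (ZMod ℓ) (geomTorsion W ℓ) := AddSubgroup.torsionBy.zmodModule
  have hℓ' : (ℓ : AlgebraicClosure ℚ) ≠ 0 := hℓ0
  have hcard : Nat.card (geomTorsion W ℓ) = ℓ ^ 2 :=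
    card_torsionPoints_eq_sq_holds W (AlgebraicClosure ℚ) (n := ℓ) hℓ'
  haveI : Finite (geomTorsion W ℓ) := Nat.finite_of_card_ne_zero (by rw [hcard]; positivity)
  haveI : Nontrivial (geomTorsion W ℓ) := Finite.one_lt_card_iff_nontrivial.mp (by
    rw [hcard]; nlinarith [hp.two_le])
  obtain ⟨P₀, hP₀0⟩ := exists_ne (0 : geomTorsion W ℓ)
  have hP₀0' : (P₀ : W.geomPoints) ≠ 0 := fun h ↦ hP₀0 (Subtype.ext h)
  obtain ⟨x₀, y₀, h₀, hP₀xy⟩ := geomPoints.exists_eq_some (P := (P₀ : W.geomPoints)) hP₀0'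
  have hP₀t : (ℓ : ℤ) • (P₀ : W.geomPoints) = 0 := (Submodule.mem_torsionBy_iff _ _).mp P₀.2
  set t₀ := x₀ / y₀ with ht₀def
  obtain ⟨ht₀1, ht₀n⟩ := valuation_param_pow_eq ℓ hΔ hss hℓ2 hP₀t hP₀xy
  rw [← ht₀def] at ht₀1 ht₀n
  have ht₀0 : v t₀ ≠ 0 := by
    intro h0
    rw [h0, zero_pow hn0] at ht₀n
    exact hvℓ0 ht₀n.symm
  have ht₀ne : t₀ ≠ 0 := fun h ↦ ht₀0 (by rw [h, map_zero])
  -- the points `s • P₀` and `v (s t₀) = v t₀`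
  have hsP : ∀ s : absoluteGaloisGroup ℚ, ∃ h', ((s • P₀ : geomTorsion W ℓ) : W.geomPoints) =
      .some (s • x₀) (s • y₀) h' := fun s ↦ exists_smul_eq_some (W := W) s hP₀xy
  have hsPt : ∀ s : absoluteGaloisGroup ℚ, (ℓ : ℤ) • ((s • P₀ : geomTorsion W ℓ) : W.geomPoints) =
      0 := fun s ↦ (Submodule.mem_torsionBy_iff _ _).mp (s • P₀).2
  have hvs : ∀ s : absoluteGaloisGroup ℚ, v (s • t₀) = v t₀ := by
    intro s
    obtain ⟨h', hs'⟩ := hsP s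
    have := valuation_param_eq_of_zsmul_eq_zero ℓ hΔ hss hℓ2 (hsPt s) hP₀t hs' hP₀xy
    rwa [smul_div_eq] at this
  -- the tame character `θ(s) = s t₀ / t₀ mod 𝔪`
  set θ : absoluteGaloisGroup ℚ → AlgebraicClosure ℚ := fun s ↦ s • t₀ / t₀ with hθ
  have hθv : ∀ s, v (θ s) = 1 := fun s ↦ by rw [hθ]; dsimp only; rw [map_div₀, hvs, div_self ht₀0]
  have hθmem : ∀ s, θ s ∈ placeOver ℓ := fun s ↦ hmem1 (hθv s)
  set u : absoluteGaloisGroup ℚ → placeOver ℓ := fun s ↦ ⟨θ s, hθmem s⟩ with hu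
  have hu0 : ∀ s, r (u s) ≠ 0 := fun s ↦ by
    rw [Ne, hr, placeResidueMap_eq_zero_iff]
    exact (hθv s).symm ▸ lt_irrefl 1
  have hst₀ : ∀ s : absoluteGaloisGroup ℚ, s • t₀ = θ s * t₀ := fun s ↦ by
    rw [hθ]; dsimp only; rw [div_mul_cancel₀ _ ht₀ne]
  -- inertia acts trivially on residues of units
  have hfix : ∀ {s : absoluteGaloisGroup ℚ}, s ∈ I → ∀ (z : AlgebraicClosure ℚ) (hz : z ∈ placeOver ℓ)
      (hsz : s • z ∈ placeOver ℓ), r ⟨s • z, hsz⟩ = r ⟨z, hz⟩ := fun hs z hz hsz ↦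
    placeResidueMap_eq_of_valuation_sub_lt ℓ
      (valuation_smul_sub_lt_one_of_mem_inertia hmem hs hz)
  have hsmem : ∀ {s : absoluteGaloisGroup ℚ}, s ∈ I → ∀ {z : AlgebraicClosure ℚ},
      z ∈ placeOver ℓ → s • z ∈ placeOver ℓ := by
    intro s hs z hz
    have hstab := smul_placeOver_eq_of_mem_inertia (p := ℓ) hmem hs
    rw [← hstab, absoluteGaloisGroup.smul_def]
    exact ValuationSubring.smul_mem_pointwise_smul _ _ _ hz
  -- `θ` is multiplicative on `I` modulo `𝔪`
  have hmul : ∀ s s' : I, r (u (s * s')) = r (u s) * r (u s') := by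
    rintro ⟨s, hs⟩ ⟨s', hs'⟩
    have hss'mem : s • θ s' ∈ placeOver ℓ := hsmem hs (hθmem s')
    have hst₀0 : absoluteGaloisGroup.toAlgEquiv ℚ s t₀ ≠ 0 := fun h ↦ by
      have := hvs s
      rw [absoluteGaloisGroup.smul_def, h, map_zero] at this
      exact ht₀0 this.symm
    have heq : u (s * s') = ⟨s • θ s', hss'mem⟩ * u s := by
      apply Subtype.ext
      change (s * s') • t₀ / t₀ = s • (s' • t₀ / t₀) * (s • t₀ / t₀)
      rw [mul_smul]
      simp only [absoluteGaloisGroup.smul_def, map_div₀]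
      field_simp
    change r (u (s * s')) = r (u s) * r (u s')
    rw [heq, map_mul, hfix hs (θ s') (hθmem s') hss'mem, mul_comm]
  set θbar : I →* (AlgebraicClosure (ZMod ℓ))ˣ :=
    MonoidHom.mk' (fun s ↦ Units.mk0 (r (u s)) (hu0 s)) (fun s s' ↦ Units.ext (by
      simp only [Units.val_mk0, Units.val_mul]; exact hmul s s')) with hθbar
  have hθbar_apply : ∀ s : I, (θbar s : AlgebraicClosure (ZMod ℓ)) = r (u s) := fun s ↦ rfl
  -- **the key equivalence**: `ρ̄(s) = 1 ↔ θ(s) ≡ 1`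
  have hker : ∀ s : I, ρ s = 1 ↔ θbar s = 1 := by
    rintro ⟨s, hs⟩
    rw [galoisRepTorsion_eq_one_iff', Units.ext_iff, hθbar_apply, Units.val_one, hres1]
    change (∀ P : geomTorsion W ℓ, s • P = P) ↔ v (θ s - 1) < 1
    have hθs : θ s - 1 = (s • t₀ - t₀) / t₀ := by
      rw [hθ]; dsimp only; rw [sub_div, div_self ht₀ne]
    rw [hθs, map_div₀, div_lt_one_iff_of_ne_zero ht₀0]
    constructor
    · intro hall
      have h1 : ((s • P₀ : geomTorsion W ℓ) : W.geomPoints) = (P₀ : W.geomPoints) := by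
        rw [hall P₀]
      obtain ⟨h', hs'⟩ := hsP s
      rw [hs', hP₀xy] at h1
      obtain ⟨hx, hy⟩ := (Affine.Point.some.injEq _ _ _ _ _ _).mp h1
      rw [← smul_div_eq, hx, hy, ← ht₀def, sub_self, map_zero]
      exact zero_lt_iff.mpr ht₀0
    · intro hlt
      exact smul_eq_self_of_valuation_smul_param_sub_lt ℓ hΔ hss hℓ2 hmem hs hP₀t hP₀xy hlt
  have hkereq : (ρ.restrict I).ker = θbar.ker := by
    ext s
    rw [MonoidHom.mem_ker, MonoidHom.mem_ker, MonoidHom.restrict_apply]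
    exact hker s
  -- `ρ̄(I) ≃ θ(I)`
  have e : (ρ.restrict I).range ≃* θbar.range :=
    (QuotientGroup.quotientKerEquivRange _).symm.trans
      ((QuotientGroup.quotientMulEquivOfEq hkereq).trans (QuotientGroup.quotientKerEquivRange _))
  have hH : I.map ρ = (ρ.restrict I).range := (MonoidHom.restrict_range (K := I) (f := ρ)).symm
  -- `θ(I) ≤ μ_n`: `θ(s)^n = s(c)/c ≡ 1` with `c = t₀^n / ℓ` a unit
  have hle : θbar.range ≤ rootsOfUnity n (AlgebraicClosure (ZMod ℓ)) := by
    rintro _ ⟨⟨s, hs⟩, rfl⟩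
    rw [mem_rootsOfUnity, Units.ext_iff, Units.val_pow_eq_pow_val, hθbar_apply, Units.val_one,
      ← map_pow, hres1, SubmonoidClass.coe_pow]
    change v (θ s ^ n - 1) < 1
    set c := t₀ ^ n / ℓ with hc
    have hvc : v c = 1 := by
      rw [hc, map_div₀, map_pow, ht₀n, div_self hvℓ0]
    have hcmem : c ∈ placeOver ℓ := hmem1 hvc
    have hc0 : c ≠ 0 := fun h ↦ by rw [h, map_zero] at hvc; exact zero_ne_one hvc
    have ht₀c : t₀ ^ n = c * ℓ := by rw [hc, div_mul_cancel₀ _ hℓ0]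
    have hsℓ : s • ((ℓ : ℕ) : AlgebraicClosure ℚ) = ℓ := by
      rw [absoluteGaloisGroup.smul_def, map_natCast]
    have hθn : θ s ^ n - 1 = (s • c - c) / c := by
      rw [hθ]; dsimp only
      rw [div_pow, ← smul_pow', ht₀c, smul_mul', hsℓ, mul_div_mul_right _ _ hℓ0, sub_div,
        div_self hc0]
    rw [hθn, map_div₀, hvc, div_one]
    exact valuation_smul_sub_lt_one_of_mem_inertia hmem hs hcmem
  haveI : NeZero n := ⟨hn0⟩
  haveI : Finite θbar.range :=
    Finite.of_injective (Subgroup.inclusion hle) (Subgroup.inclusion_injective hle)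
  have hRle : Nat.card θbar.range ≤ n :=
    (Subgroup.card_le_of_le hle).trans (card_rootsOfUnity _ n)
  -- an element of order `n`: `θ(s₀) ≡ ζ` for `s₀ π = ζ π`
  obtain ⟨π, hπ⟩ := IsAlgClosed.exists_pow_nat_eq (ℓ : AlgebraicClosure ℚ) hnpos
  haveI : NeZero ((n : ℕ) : AlgebraicClosure ℚ) := ⟨Nat.cast_ne_zero.mpr hn0⟩
  obtain ⟨ζ, hζ⟩ := IsAlgClosed.exists_root (cyclotomic n (AlgebraicClosure ℚ))
    (degree_cyclotomic_pos n _ hnpos).ne'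
  have hζprim : IsPrimitiveRoot ζ n := isRoot_cyclotomic_iff.mp hζ
  obtain ⟨s₀, hs₀I, hs₀⟩ := hT π ζ hπ hζprim.pow_eq_one
  have hvζ : v ζ = 1 := by
    have h1 : v ζ ^ n = 1 ^ n := by rw [← map_pow, hζprim.pow_eq_one, map_one, one_pow]
    exact pow_left_injective_of_ne_zero hn0 h1
  have hζmem : ζ ∈ placeOver ℓ := hmem1 hvζ
  have hvπ : v π = v t₀ := by
    have h1 : v π ^ n = v t₀ ^ n := by rw [← map_pow, hπ, ht₀n]
    exact pow_left_injective_of_ne_zero hn0 h1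
  have hπ0 : π ≠ 0 := fun h ↦ ht₀0 (by rw [← hvπ, h, map_zero])
  have hθs₀ : r (u s₀) = r ⟨ζ, hζmem⟩ := by
    apply placeResidueMap_eq_of_valuation_sub_lt ℓ
    change v (θ s₀ - ζ) < 1
    set w := t₀ / π with hw
    have hvw : v w = 1 := by rw [hw, map_div₀, hvπ, div_self ht₀0]
    have hwmem : w ∈ placeOver ℓ := hmem1 hvw
    have hw0 : w ≠ 0 := fun h ↦ by rw [h, map_zero] at hvw; exact zero_ne_one hvw
    have ht₀w : t₀ = π * w := by rw [hw, mul_div_cancel₀ _ hπ0]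
    have : θ s₀ - ζ = ζ * ((s₀ • w - w) / w) := by
      rw [hθ]; dsimp only
      rw [ht₀w, smul_mul', hs₀]
      field_simp
    rw [this, map_mul, hvζ, one_mul, map_div₀, hvw, div_one]
    exact valuation_smul_sub_lt_one_of_mem_inertia hmem hs₀I hwmem
  have hθbar_pow : ∀ s : I, θbar s ^ n = 1 := fun s ↦
    (mem_rootsOfUnity _ _).mp (hle ⟨s, rfl⟩)
  have hprim : IsPrimitiveRoot (θbar ⟨s₀, hs₀I⟩) n := by
    refine ⟨hθbar_pow _, fun l hl ↦ hζprim.dvd_of_pow_eq_one l ?_⟩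
    -- `θ(s₀)^l = 1 ⇒ ζ^l ≡ 1 ⇒ ζ^l = 1`
    rw [Units.ext_iff, Units.val_pow_eq_pow_val, hθbar_apply, Units.val_one] at hl
    change r (u s₀) ^ l = 1 at hl
    rw [hθs₀, ← map_pow, hres1, SubmonoidClass.coe_pow] at hl
    change v (ζ ^ l - 1) < 1 at hl
    refine eq_one_of_pow_eq_one_of_valuation_sub_one_lt ℓ hnℓ ?_ hl
    rw [← pow_mul, mul_comm, pow_mul, hζprim.pow_eq_one, one_pow]
  -- conclusion for `θ(I)`: cyclic of order `n`
  set R := θbar.range with hR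
  set g : R := ⟨θbar ⟨s₀, hs₀I⟩, ⟨⟨s₀, hs₀I⟩, rfl⟩⟩ with hg
  have hordg : orderOf g = n := by
    have h1 : orderOf (R.subtype g) = orderOf g := orderOf_injective R.subtype Subtype.coe_injective g
    rw [← h1]
    exact hprim.eq_orderOf.symm
  have hRcyc : IsCyclic R := isCyclic_of_card_le_orderOf g (by rw [hordg]; exact hRle)
  have hRcard : Nat.card R = n := by
    refine le_antisymm hRle ?_
    rw [← hordg]
    exact Nat.le_of_dvd (Nat.card_pos) (orderOf_dvd_natCard g)
  -- transfer to `ρ̄(I)`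
  rw [hH]
  refine ⟨isCyclic_of_surjective e.symm e.symm.surjective, ?_⟩
  rw [Nat.card_congr e.toEquiv, hRcard]

end Supersingular

end Literature.NumberTheory.EllipticCurves
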